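import Summits.QuantumFields.BalabanUV.T4Continuum.Support.RegionTaylorColumns
import Summits.QuantumFields.BalabanUV.T4Continuum.Support.RegionInteriorGaffney
import Summits.QuantumFields.BalabanUV.T4Continuum.Support.GaugeTermResolventBounds
import Summits.QuantumFields.BalabanUV.Beta.GAN24.DirichletBoxTwoLevel

/-!
# T⁴ programme, spine node NE2 (U1a), sub-row Δ1 «NE2⁰-Dirichlet» — owner item O15-a, LEAF (B) «GAUGE-COLUMNS-TWO-LEVEL», file B3b:
# THE IDENTITIES — planted block data, the region divergence identity, `Π′J₀ = J₀Π`, and the representation of `ψ′ − ψ̃` through `G′_{Ω′}`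

NE2 formalisation swarm `b2b-balaban-t4-ne2-formalise-*`, LEAF PROVER 05 (gen 9); owner rulings R35 (c) / R36 (a) (journal
`CLAIMS.log` 2026-08-20 l.22128 / l.22328; targets VERBATIM = `hB` of `RegionGaugeResolventTower.hinjK_of_local`, p238533).  Route «H⁻¹»
(this seat, journal l.22634; NO energy trick): with `ψ = G′_Ω f`, `f = Q̂′ᴴφ` (`Q̂′ = √(n^d)•Q′_Ω`), the Taylor-planted `ψ̃ = TcR ψ` (B3a),
`g = gdefR ψ`, `h = hR ψ`,

 * §1 the identities: `f′ = J0R f` (block data plants exactly, `smul_QOm_conjTranspose_succ_mulVec`), the REGION DIVERGENCE IDENTITY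
   **`gradR_conjTranspose_JstarR_sub`**: `gradR′ᴴ(JstarR·u) − J0R·(gradRᴴu) = gradR′ᴴ(hR ψ)` on `Ω′` for `u = gradR ψ` (B2's torus identity read
   through the region: only star bonds touch a region site), `PiR_succ_mul_J0R` (`Π′_{Ω′}·J0R = J0R·Π_Ω`), `DOm_eq_gradR` (`D_Ω = ∂_Ωᴴ∂_Ω + a′Π_Ω`),
   and THE REPRESENTATION **`fine_sub_taylor_eq`**:
   `G′_{Ω′}f′ − TcR ψ = −G′_{Ω′}·[gradR′ᴴ(g + h) + a′Π′_{Ω′}(TcR ψ − J0R ψ)]`;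
 File B3c (`RegionGaugeColumnsTwoLevel`) does §2–§3 below on top of this file:
 * §2 THE TRANSFER (pure operator algebra, lineage `GaugeTermResolventBounds.opNorm_mul_inv_mul_conjTranspose_le_one : ‖X S⁻¹ Xᴴ‖ ≤ 1`,
   `opNorm_mul_inv_le_sqrt`): **`nsq_columns_sub_le`**:
   `nsq (B̂′φ − JstarR·B̂φ) ≤ 3·(4·nsq g + nsq h + a′²γ′⁻¹·nsq (TcR ψ − J0R ψ))`;
 * §3 THE BUDGETS on a coordinate box (`n ≥ 2`): B3a's `nsq_gdefR_le` / `nsq_hR_le` + leaf-06-g6's `RegionStarTrace.trace_deficient_le` +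
   leaf-07-g7's `RegionInteriorGaffney.interior_gaffney_box` (⇒ `Σ_ν nsq (igrad_ν (gradR ψ)) ≤ Σ_Ω|Δψ|²`, `curl ∘ grad = 0`) + gan24's
   corner-free H² (`sum_normSq_LapS_solExt_le`, `sum_normSq_LapS_eq`, `cornerFree_blockReg`) + B1's `norm_sq_mul_nsq_taylorJ_sub_JK0_le`
   ⟹ **`nsq_columns_sub_le_box`**: `nsq (B̂′φ − JstarR·B̂φ) ≤ CgaugeBsq d L a′·n⁻¹·nsq φ` and the END
   **`opNorm_regionBh_succ_sub_le`**: `‖regionBh (L·n) M a′ S − JstarR·regionBh n M a′ S‖ ≤ √(CgaugeBsq d L a′)·(√n)⁻¹` — leaf (B) at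
   the rate `n_k^{−1/2} = (√L)^{−k}` (the tower spelling `hB` along `lev L k`, with `k = 0` by the trivial bound, is a three-line corollary
   left to the consumer / file B4 together with (Bᵗ)).

HONEST FRAMING (T4-DAG p. 1).  `U = 1`; ONE region = a coordinate box of unit blocks; ONE averaging scale; finite torus; operator norm;
constants OURS and crude; lattice bookkeeping [folklore] over landed modules; the leading loss is the LOW-WALL leak (coarse and fine Dirichlet
walls differ by `L − 1` fine spacings there) — rate `n^{−1/2}`, not `n⁻¹`; (Bᵗ), (L), the tower END NOT touched; `hinjK` / W3 on boxes
OPEN; NE2 (U1a) NOT proved; spine PROVED 0/9 unchanged; NOT [B9] (3.23)–(3.27) as printed; NOT infinite volume / mass gap / Clay.  HONEST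
DEPENDENCY: continuum YM on T⁴ ⇐ BetaPertH ∧ nine spine estimates (0/9 proved); BetaPertH ⇐ (D1) ∧ (D4) ∧ CAP+tail; G-an2-4 gates asym,
D1 and NE2/3/4.  No `sorry`.
-/

noncomputable section

open scoped BigOperators ComplexConjugate Matrix Matrix.Norms.L2Operator ComplexOrder
open Finset

namespace Summit.QuantumFields.BalabanUV.T4Continuum.RegionGaugeColumnsIdentities

open Literature.MathematicalPhysics.QuantumFieldTheory.Balaban1983to89.B5Prop11Plancherel (Tor fine unitVec)
open Literature.MathematicalPhysics.QuantumFieldTheory.Balaban1983to89.B5Prop11Lower (nsq nsq_nonneg)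
open Literature.MathematicalPhysics.QuantumFieldTheory.Balaban1983to89.B5Action121 (sdiff GradOp LapS GradOp_mulVec sdiff_mulVec)
open Literature.MathematicalPhysics.QuantumFieldTheory.Balaban1983to89.B5Block118 (QsOp)
open Literature.MathematicalPhysics.QuantumFieldTheory.Balaban1983to89.B5Blocks16 (blockOf)
open Summit.QuantumFields.BalabanUV.T4Continuum
open Summit.QuantumFields.BalabanUV.T4Continuum.SubtypeCompression (ext ext_apply_of ext_apply_of_not nsq_ext toBlock_mul_of_vanish_left
  toBlock_mul_of_vanish_right toBlock_smul toBlock_add toBlock_conjTranspose)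
open Summit.QuantumFields.BalabanUV.T4Continuum.BalabanAveragedTowerModes (par)
open Summit.QuantumFields.BalabanUV.T4Continuum.KingPairingPlantedLaw (JK)
open Summit.QuantumFields.BalabanUV.T4Continuum.ScalarBlockPoincare (PiS QsOp_apply_blockOf nsq_PiS_mulVec_le nsq_add_le nsq_smul)
open Summit.QuantumFields.BalabanUV.T4Continuum.ScalarAveragedPropagator (DeltaPs gammaPs gammaPs_pos dirichlet opNorm_le_of_nsq_le_rect)
open Summit.QuantumFields.BalabanUV.T4Continuum.ScalarBlockPlanting (JK0)
open Summit.QuantumFields.BalabanUV.T4Continuum.ScalarPlantingDefect (blockOf_par PiS_mul_JK0)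
open Summit.QuantumFields.BalabanUV.T4Continuum.RegionGaugeFixedVector (starReg gradR curlR GradOp_apply_eq_zero_of_not_star
  gradR_conjTranspose_mul_gradR toBlock_PiS curlR_mul_gradR QsOp_apply_eq_zero)
open Summit.QuantumFields.BalabanUV.T4Continuum.RegionScalarCompression (QOm GOm DOm_mul_GOm GOm_mul_DOm GOm_isHermitian)
open Summit.QuantumFields.BalabanUV.T4Continuum.RegionGaugeResolventSplit (regionBh nsq_regionBh_mulVec_le)
open Summit.QuantumFields.BalabanUV.T4Continuum.RegionStarTrace (defSet mem_defSet trace_deficient_le)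
open Summit.QuantumFields.BalabanUV.T4Continuum.RegionInteriorGaffney (interior_gaffney_box)
open Summit.QuantumFields.BalabanUV.T4Continuum.CellTaylorPlanting (cJ taylorJ JK0_mulVec norm_sq_mul_nsq_taylorJ_sub_JK0_le)
open Summit.QuantumFields.BalabanUV.T4Continuum.CellDivergencePlanting (fluxJ GradOp_conjTranspose_mulVec GradOp_conjTranspose_JK_sub_JK0_apply)
open Summit.QuantumFields.BalabanUV.T4Continuum.RegionTaylorColumns (ext_gradR JstarR JstarR_mulVec TcR TcR_mulVec gdefR hR nsq_gdefR_le
  nsq_hR_le sum_subtype_le_sum')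
open Summit.QuantumFields.BalabanUV.Beta.GAN24.DirichletBoxCompression (DOm DOm_isHermitian isUnit_det_DOm opNorm_inv_DOm_le solExt
  toBlock_mulVec' JK0_vanish_right refineR sum_normSq_LapS_solExt_le dirichlet_solExt_le nsq_solExt_le)
open Summit.QuantumFields.BalabanUV.Beta.GAN24.DirichletBoxTrace (blockReg)
open Summit.QuantumFields.BalabanUV.Beta.GAN24.DirichletBoxTwoLevelCore (refineR_blockReg_iff)
open Summit.QuantumFields.BalabanUV.Beta.GAN24.DirichletBoxTwoLevel (IsCoordBox cornerFree_blockReg)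
open Summit.QuantumFields.BalabanUV.Beta.GAN24.DirichletBoxRegularity (Hdiag Hmixed hdiag_le_sum_normSq_LapS sum_normSq_LapS_eq SuppIn
  hmixed_nonneg hdiag_nonneg)

variable {d : ℕ} (n L : ℕ) [NeZero n] [NeZero L] (M : Fin d → ℕ) [hM : ∀ μ, NeZero (M μ)] (a' : ℝ) (S : Tor M → Prop) [DecidablePred S]

/-! ## §1 Identities: planted data, the region divergence identity, `Π′J₀ = J₀Π`, the representation -/

/-- the SCALAR CELL PLANTING compressed to the region, `J0R = (J₀)_{Ω′Ω}` (road P2's `JOm` / the tower's `JsR`, `blockReg` spelling). [folklore] -/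
def J0R : Matrix {x // blockReg (L * n) M S x} {x // blockReg n M S x} ℂ := (JK0 n L M).toBlock (blockReg (L * n) M S) (blockReg n M S)

omit [DecidablePred S] in
/-- `J₀` never plants a region site on an exterior fine site. [folklore] -/
theorem JK0_vanish : ∀ (x : Tor (fine (L * n) M)) (y : Tor (fine n M)), ¬ blockReg (L * n) M S x → blockReg n M S y → JK0 n L M x y = 0 :=
  fun x y hx hy => JK0_vanish_right n L M (blockReg n M S) x y (fun h => hx ((refineR_blockReg_iff n L M S x).mp h)) hy

/-- `(J0R w)(x′) = (J₀·ext w)(x′) = cJ·w(par x′)`. [folklore] -/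
theorem J0R_mulVec (w : {x // blockReg n M S x} → ℂ) (a : {x // blockReg (L * n) M S x}) :
    (J0R n L M S *ᵥ w) a = cJ d L * ext (blockReg n M S) w (par n L M a.1) := by
  unfold J0R
  rw [toBlock_mulVec']
  exact JK0_mulVec n L M (ext (blockReg n M S) w) a.1

omit [DecidablePred S] in
/-- the parent of a region fine site is a region site. [folklore] -/
theorem blockReg_par (a : {x // blockReg (L * n) M S x}) : blockReg n M S (par n L M a.1) := by
  show S (blockOf n M (par n L M a.1)); rw [blockOf_par]; exact a.2

/-- the isometric block data `f = √(n^d)•Q′_Ωᴴφ`. [folklore] -/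
def fdata (φ : {y // S y} → ℂ) : {x // blockReg n M S x} → ℂ := (((Real.sqrt ((n : ℝ) ^ d)) : ℝ) : ℂ) • ((QOm n M S)ᴴ *ᵥ φ)

/-- entries of the block data: `f(x) = √(n^d)·n^{−d}·φ(blockOf x)`. [folklore] -/
theorem fdata_apply (φ : {y // S y} → ℂ) (x : {x // blockReg n M S x}) :
    fdata n M S φ x = (((Real.sqrt ((n : ℝ) ^ d)) : ℝ) : ℂ) * ((1 / (n : ℂ) ^ d) * φ ⟨blockOf n M x.1, x.2⟩) := by
  unfold fdata QOm
  rw [Pi.smul_apply, smul_eq_mul]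
  congr 1
  simp only [Matrix.mulVec, dotProduct, Matrix.conjTranspose_apply, Matrix.toBlock_apply]
  rw [Finset.sum_eq_single ⟨blockOf n M x.1, x.2⟩]
  · rw [QsOp_apply_blockOf, if_pos rfl]
    simp
  · intro y _ hy
    rw [QsOp_apply_eq_zero n M (fun h => hy (Subtype.ext h.symm)), star_zero, zero_mul]
  · intro h; exact absurd (Finset.mem_univ _) h

/-- **BLOCK DATA PLANT EXACTLY**: `f′ = J0R·f`, i.e. `√(n′^d)•Q′_{Ω′}ᴴφ = J0R·(√(n^d)•Q′_Ωᴴφ)`. [folklore] -/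
theorem fdata_succ_eq (φ : {y // S y} → ℂ) : fdata (L * n) M S φ = J0R n L M S *ᵥ fdata n M S φ := by
  funext a
  rw [J0R_mulVec, ext_apply_of _ _ ⟨par n L M a.1, blockReg_par n L M S a⟩, fdata_apply, fdata_apply]
  have hb : (⟨blockOf n M (par n L M a.1), blockReg_par n L M S a⟩ : {y // S y}) = ⟨blockOf (L * n) M a.1, a.2⟩ :=
    Subtype.ext (blockOf_par n L M a.1)
  rw [hb]
  unfold cJ
  have hL : (0 : ℝ) < L := Nat.cast_pos.mpr (Nat.pos_of_ne_zero (NeZero.ne L))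
  have hn : (0 : ℝ) < n := Nat.cast_pos.mpr (Nat.pos_of_ne_zero (NeZero.ne n))
  have hLc : (L : ℂ) ≠ 0 := by exact_mod_cast hL.ne'
  have hnc : (n : ℂ) ≠ 0 := by exact_mod_cast hn.ne'
  have e : Real.sqrt (((L * n : ℕ) : ℝ) ^ d) = Real.sqrt ((L : ℝ) ^ d) * Real.sqrt ((n : ℝ) ^ d) := by
    rw [← Real.sqrt_mul (pow_nonneg hL.le d), ← mul_pow]; push_cast; ring_nf
  rw [e]
  push_cast
  field_simp
  ring

/-- the region gradient's adjoint reads the zero extension: `(gradRᴴ v)(x) = ((∂)ᴴ (ext v))(x)` on `Ω`. [folklore] -/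
theorem gradR_conjTranspose_mulVec (v : {b // starReg n M S b} → ℂ) (x : {x // blockReg n M S x}) :
    ((gradR n M S)ᴴ *ᵥ v) x = ((GradOp (fine n M) (n : ℂ))ᴴ *ᵥ ext (starReg n M S) v) x.1 := by
  unfold gradR
  rw [toBlock_conjTranspose, toBlock_mulVec']

omit [DecidablePred S] in
/-- the divergence at a REGION site only reads the star bonds: two 1-forms agreeing on the star bonds have the same divergence there. [folklore] -/
theorem GradOp_conjTranspose_mulVec_congr {Nf : ℕ} [NeZero Nf] (w₁ w₂ : Tor (fine Nf M) × Fin d → ℂ) (x : Tor (fine Nf M))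
    (hx : blockReg Nf M S x) (h : ∀ b, starReg Nf M S b → w₁ b = w₂ b) :
    ((GradOp (fine Nf M) (Nf : ℂ))ᴴ *ᵥ w₁) x = ((GradOp (fine Nf M) (Nf : ℂ))ᴴ *ᵥ w₂) x := by
  rw [GradOp_conjTranspose_mulVec, GradOp_conjTranspose_mulVec]
  refine Finset.sum_congr rfl fun ν _ => ?_
  have h1 : starReg Nf M S (x - unitVec (fine Nf M) ν, ν) := Or.inr (by rw [sub_add_cancel]; exact hx)
  have h2 : starReg Nf M S (x, ν) := Or.inl hx
  rw [h _ h1, h _ h2]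

/-- **THE REGION DIVERGENCE IDENTITY**: for `u = gradR ψ` and every region fine site,
`(gradR′ᴴ(JstarR·u))(x′) − (J0R·(gradRᴴu))(x′) = (gradR′ᴴ(hR ψ))(x′)` — B2's torus identity (the divergence-planting defect is the exact
divergence of the intra-cell flux), read through the region. [folklore] -/
theorem gradR_conjTranspose_JstarR_sub (ψ : {x // blockReg n M S x} → ℂ) (a : {x // blockReg (L * n) M S x}) :
    ((gradR (L * n) M S)ᴴ *ᵥ (JstarR n L M S *ᵥ (gradR n M S *ᵥ ψ))) a - (J0R n L M S *ᵥ ((gradR n M S)ᴴ *ᵥ (gradR n M S *ᵥ ψ))) a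
      = ((gradR (L * n) M S)ᴴ *ᵥ hR n L M S ψ) a := by
  set z := ext (blockReg n M S) ψ with hz
  set U := GradOp (fine n M) (n : ℂ) *ᵥ z with hU
  have hUe : ext (starReg n M S) (gradR n M S *ᵥ ψ) = U := by rw [hU, hz, ext_gradR]
  -- first term: the fine divergence of the planted field
  have h1 : ((gradR (L * n) M S)ᴴ *ᵥ (JstarR n L M S *ᵥ (gradR n M S *ᵥ ψ))) a
      = ((GradOp (fine (L * n) M) (((L * n : ℕ) : ℂ)))ᴴ *ᵥ (JK n L M *ᵥ U)) a.1 := by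
    rw [gradR_conjTranspose_mulVec]
    refine GradOp_conjTranspose_mulVec_congr M S _ _ a.1 a.2 fun b hb => ?_
    rw [ext_apply_of _ _ ⟨b, hb⟩, JstarR_mulVec, hUe]
  -- second term: the planted coarse divergence
  have h2 : (J0R n L M S *ᵥ ((gradR n M S)ᴴ *ᵥ (gradR n M S *ᵥ ψ))) a = (JK0 n L M *ᵥ ((GradOp (fine n M) (n : ℂ))ᴴ *ᵥ U)) a.1 := by
    rw [J0R_mulVec, JK0_mulVec, ext_apply_of _ _ ⟨par n L M a.1, blockReg_par n L M S a⟩, gradR_conjTranspose_mulVec, hUe]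
  -- third term: the flux
  have h3 : ((gradR (L * n) M S)ᴴ *ᵥ hR n L M S ψ) a = ((GradOp (fine (L * n) M) (((L * n : ℕ) : ℂ)))ᴴ *ᵥ fluxJ n L M U) a.1 := by
    rw [gradR_conjTranspose_mulVec]
    refine GradOp_conjTranspose_mulVec_congr M S _ _ a.1 a.2 fun b hb => ?_
    rw [ext_apply_of _ _ ⟨b, hb⟩]
    rfl
  rw [h1, h2, h3]
  have e := GradOp_conjTranspose_JK_sub_JK0_apply n L M (n : ℂ) U a.1
  push_cast at e ⊢
  exact e

/-- the compressed block-mean projector `Π_Ω = (Π′)_{ΩΩ}`. [folklore] -/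
def PiR : Matrix {x // blockReg n M S x} {x // blockReg n M S x} ℂ := (PiS n M).toBlock (blockReg n M S) (blockReg n M S)

/-- `Π′` couples only sites of the same unit block. [folklore] -/
theorem PiS_apply_eq_zero_of_ne {x y : Tor (fine n M)} (h : blockOf n M x ≠ blockOf n M y) : PiS n M x y = 0 := by
  unfold PiS
  rw [Matrix.smul_apply, Matrix.mul_apply, smul_eq_mul]
  have : ∑ j, (QsOp n M)ᴴ x j * QsOp n M j y = 0 := Finset.sum_eq_zero fun j _ => by
    rw [Matrix.conjTranspose_apply]
    by_cases hj : blockOf n M x = j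
    · have hjy : blockOf n M y ≠ j := fun h' => h (hj.trans h'.symm)
      rw [QsOp_apply_eq_zero n M hjy, mul_zero]
    · rw [QsOp_apply_eq_zero n M hj, star_zero, zero_mul]
  rw [this, mul_zero]

omit [DecidablePred S] in
/-- so `Π′` never couples `Ω` to its complement (either way). [folklore] -/
theorem PiS_apply_eq_zero_of {x y : Tor (fine n M)} (h : ¬ (blockReg n M S x ↔ blockReg n M S y)) : PiS n M x y = 0 :=
  PiS_apply_eq_zero_of_ne n M fun e => h (by show S (blockOf n M x) ↔ S (blockOf n M y); rw [e])

/-- **`Π′_{Ω′}·J0R = J0R·Π_Ω`** (block means of a cell-planted field are the planted block means; read through the region). [folklore] -/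
theorem PiR_succ_mul_J0R : PiR (L * n) M S * J0R n L M S = J0R n L M S * PiR n M S := by
  unfold PiR J0R
  rw [← toBlock_mul_of_vanish_left (blockReg (L * n) M S) (blockReg (L * n) M S) (blockReg n M S) (PiS (L * n) M) (JK0 n L M)
      (fun i j hi hj => PiS_apply_eq_zero_of (L * n) M S (fun h => hj (h.mp hi))),
    ← toBlock_mul_of_vanish_right (blockReg (L * n) M S) (blockReg n M S) (blockReg n M S) (JK0 n L M) (PiS n M)
      (fun j l hj hl => PiS_apply_eq_zero_of n M S (fun h => hj (h.mpr hl))),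
    PiS_mul_JK0]

/-- `D_Ω = ∂_Ωᴴ∂_Ω + a′Π_Ω` on the region. [folklore] -/
theorem DOm_eq_gradR : DOm n M a' (blockReg n M S) = (gradR n M S)ᴴ * gradR n M S + ((a' : ℂ)) • PiR n M S := by
  unfold DOm DeltaPs PiR
  rw [toBlock_add, toBlock_smul, gradR_conjTranspose_mul_gradR]

/-- `a′Π_Ω` is positive semidefinite (`Π_Ω = n^d·Q′_ΩᴴQ′_Ω`). [folklore] -/
theorem smul_PiR_posSemidef (ha' : 0 ≤ a') : (((a' : ℂ)) • PiR n M S).PosSemidef := by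
  unfold PiR
  rw [toBlock_PiS, smul_smul]
  have e : ((a' : ℂ) * (n : ℂ) ^ d) • ((QOm n M S)ᴴ * QOm n M S)
      = ((((Real.sqrt (a' * (n : ℝ) ^ d)) : ℝ) : ℂ) • QOm n M S)ᴴ * ((((Real.sqrt (a' * (n : ℝ) ^ d)) : ℝ) : ℂ) • QOm n M S) := by
    rw [Matrix.conjTranspose_smul, Matrix.smul_mul, Matrix.mul_smul, smul_smul, Complex.star_def, Complex.conj_ofReal, ← Complex.ofReal_mul,
      Real.mul_self_sqrt (by positivity)]
    push_cast; rfl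
  rw [e]
  exact Matrix.posSemidef_conjTranspose_mul_self _

/-- **THE REPRESENTATION**: with `ψ = G′_Ωf`, `ψ̃ = TcR ψ`, `g = gdefR ψ`, `h = hR ψ`:
`G′_{Ω′}(J0R f) − ψ̃ = −G′_{Ω′}·[gradR′ᴴ(g + h) + a′Π′_{Ω′}(ψ̃ − J0R ψ)]`. [folklore] -/
theorem fine_sub_taylor_eq (ha' : 0 < a') (f : {x // blockReg n M S x} → ℂ) :
    GOm (L * n) M a' S *ᵥ (J0R n L M S *ᵥ f) - TcR n L M S *ᵥ (GOm n M a' S *ᵥ f)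
      = -(GOm (L * n) M a' S *ᵥ ((gradR (L * n) M S)ᴴ *ᵥ (gdefR n L M S (GOm n M a' S *ᵥ f) + hR n L M S (GOm n M a' S *ᵥ f))
          + ((a' : ℂ)) • (PiR (L * n) M S *ᵥ (TcR n L M S *ᵥ (GOm n M a' S *ᵥ f) - J0R n L M S *ᵥ (GOm n M a' S *ᵥ f))))) := by
  set ψ := GOm n M a' S *ᵥ f with hψ
  set ψt := TcR n L M S *ᵥ ψ with hψt
  -- `f = D_Ω ψ`
  have hf : f = DOm n M a' (blockReg n M S) *ᵥ ψ := by
    rw [hψ, Matrix.mulVec_mulVec, DOm_mul_GOm n M a' S ha', Matrix.one_mulVec]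
  -- `D′ψ̃ − J0R f = gradR′ᴴ(g + h) + a′Π′(ψ̃ − J0Rψ)`
  have hρ : DOm (L * n) M a' (blockReg (L * n) M S) *ᵥ ψt - J0R n L M S *ᵥ f
      = (gradR (L * n) M S)ᴴ *ᵥ (gdefR n L M S ψ + hR n L M S ψ) + ((a' : ℂ)) • (PiR (L * n) M S *ᵥ (ψt - J0R n L M S *ᵥ ψ)) := by
    rw [hf, DOm_eq_gradR, DOm_eq_gradR, Matrix.add_mulVec, Matrix.add_mulVec, Matrix.smul_mulVec, Matrix.smul_mulVec,
      Matrix.mulVec_add, Matrix.mulVec_smul, ← Matrix.mulVec_mulVec, ← Matrix.mulVec_mulVec]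
    -- `gradR′ ψt = JstarR u + g`
    have hg : gradR (L * n) M S *ᵥ ψt = JstarR n L M S *ᵥ (gradR n M S *ᵥ ψ) + gdefR n L M S ψ := by
      rw [hψt, gdefR]; abel
    rw [hg, Matrix.mulVec_add, Matrix.mulVec_add, Matrix.mulVec_sub, smul_sub]
    -- the divergence identity and `Π′J0R = J0RΠ`
    have hdiv : (gradR (L * n) M S)ᴴ *ᵥ (JstarR n L M S *ᵥ (gradR n M S *ᵥ ψ)) - J0R n L M S *ᵥ ((gradR n M S)ᴴ *ᵥ (gradR n M S *ᵥ ψ))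
        = (gradR (L * n) M S)ᴴ *ᵥ hR n L M S ψ := funext fun a => by
      rw [Pi.sub_apply]; exact gradR_conjTranspose_JstarR_sub n L M S ψ a
    have hPi : ∀ w : {x // blockReg n M S x} → ℂ, J0R n L M S *ᵥ (PiR n M S *ᵥ w) = PiR (L * n) M S *ᵥ (J0R n L M S *ᵥ w) :=
      fun w => by rw [Matrix.mulVec_mulVec, Matrix.mulVec_mulVec, PiR_succ_mul_J0R]
    rw [hPi]
    have := hdiv
    rw [sub_eq_iff_eq_add] at this
    rw [this]
    abel
  -- `G′ψ′ − ψ̃ = G′(J0Rf) − G′D′ψ̃ = −G′(D′ψ̃ − J0Rf)`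
  have hGD : GOm (L * n) M a' S *ᵥ (DOm (L * n) M a' (blockReg (L * n) M S) *ᵥ ψt) = ψt := by
    rw [Matrix.mulVec_mulVec, GOm_mul_DOm (L * n) M a' S ha', Matrix.one_mulVec]
  calc GOm (L * n) M a' S *ᵥ (J0R n L M S *ᵥ f) - ψt
      = -(GOm (L * n) M a' S *ᵥ (DOm (L * n) M a' (blockReg (L * n) M S) *ᵥ ψt - J0R n L M S *ᵥ f)) := by
        rw [Matrix.mulVec_sub, hGD]; abel
    _ = _ := by rw [hρ]

end Summit.QuantumFields.BalabanUV.T4Continuum.RegionGaugeColumnsIdentities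

end
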